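import Mathlib
import Summits.Ventures.PercRepro.TriangleCapSubBandMax
import Summits.Ventures.PercRepro.TriangleCapDeepThreeWitness

/-!
# PercRepro — THE TOP OF EVERY SUB-BAND `u ≥ ℓ − 1`, FOR EVERY `ℓ`, IN THE MAXIMUM-DEGREE SEMANTICS
(p3, gen 54; part 297)

For `ℓ − 1 ≤ u` the width `twoW ℓ u` has no non-leaf-end term, so the sub-band bound of part 293 reads
`2 j ≤ deepTop t (ℓ − 1) u = 2 u (t − u − 1) + u (u + 1) − coll u (lfRR (ℓ − 1) 0)` for every graph whose off-edge
graph has maximum degree exactly `t − u` (`2 ≤ ℓ`, `u + 1 ≤ t`).  THE ROUND-ROBIN WITNESS attains it with maximum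
off-degree exactly `t − u` as soon as the `u` off-edges fit under `D = t − u` on the `ℓ − 1` carriers
(`u ≤ (ℓ − 1) D`): the `D`-star at the non-neighbour `1`, the `u` off-edges round robin over `2, …, ℓ`, every pair at
a fresh leaf (`lfTopAll`, `rfFresh`; `coll lf = D (D − 1) + coll u (lfRR (ℓ − 1) 0)`, `coll rf = 0`).
THEOREM (`deep_top_max`): for `2 ≤ ℓ`, `ℓ − 1 ≤ u`, `u + 1 ≤ t`, `u ≤ (ℓ − 1)(t − u)`, `2 t ≤ s`, the top of the
sub-band `u` on `ℓ + 1 + (s − t)` vertices (maximum off-degree exactly `t − u`) is exactly `deepTop t (ℓ − 1) u / 2`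
— the bound for every graph, the round robin the witness.  Axioms: standard.
-/

namespace PercRepro

namespace TriangleCap

namespace C047

open Finset

/-- The left ends of the round-robin witness: `D` pairs at `1`, then the round robin over `2, …, ℓ`. -/
def lfTopAll (ℓ D i : ℕ) : ℕ := if i < D then 1 else 1 + lfRR (ℓ - 1) 0 (i - D)

/-- Fresh leaves: the pair `i` ends at the leaf `ℓ + 1 + i`. -/
def rfFresh (ℓ i : ℕ) : ℕ := ℓ + 1 + i

/-- The bounds of `lfTopAll`: `1 ≤ lfTopAll i ≤ ℓ` (`2 ≤ ℓ`). -/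
theorem lfTopAll_bounds (ℓ D i : ℕ) (hℓ : 2 ≤ ℓ) : 1 ≤ lfTopAll ℓ D i ∧ lfTopAll ℓ D i ≤ ℓ := by
  unfold lfTopAll
  have := lfRR_bounds (ℓ - 1) 0 (i - D) (by omega)
  split_ifs <;> omega

/-- The ends are good (`2 ≤ ℓ`, `D + u = t`, `2 t ≤ s`). -/
theorem goodEnds_topAll (s ℓ t D : ℕ) (hℓ : 2 ≤ ℓ) (hs : 2 * t ≤ s) :
    GoodEnds (ℓ + 1 + (s - t)) (ℓ + 1) t (lfTopAll ℓ D) (rfFresh ℓ) := by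
  refine ⟨fun i _ => ?_, fun i hi => ?_, fun i i' _ _ _ h2 => ?_⟩
  · have := lfTopAll_bounds ℓ D i hℓ
    omega
  · unfold rfFresh
    omega
  · unfold rfFresh at h2
    omega

/-- `coll t lfTopAll = D (D − 1) + coll u (lfRR (ℓ − 1) 0)` for `t = D + u`. -/
theorem coll_lfTopAll (ℓ D u : ℕ) (hℓ : 2 ≤ ℓ) :
    coll (D + u) (lfTopAll ℓ D) = D * (D - 1) + coll u (lfRR (ℓ - 1) 0) := by
  have h : coll (D + u) (lfTopAll ℓ D) =
      coll (D + u) (fun i => if i < D then (fun _ => 1) i else (fun i' => 1 + lfRR (ℓ - 1) 0 i') (i - D)) := by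
    apply coll_congr
    intro i _
    unfold lfTopAll
    simp only
  rw [h, coll_concat D u (fun _ => 1) (fun i' => 1 + lfRR (ℓ - 1) 0 i') (fun i _ i' _ => by
    have := lfRR_bounds (ℓ - 1) 0 i' (by omega)
    show (1 : ℕ) ≠ 1 + lfRR (ℓ - 1) 0 i'
    omega), coll_const, coll_add_const]

/-- `coll t rfFresh = 0`. -/
theorem coll_rfFresh (ℓ t : ℕ) : coll t (rfFresh ℓ) = 0 := by
  apply coll_eq_zero_of_injOn
  intro i i' _ _ h
  unfold rfFresh at h
  omega

/-- The class of `1`: `D` pairs. -/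
theorem cls_lfTopAll_one (ℓ D u : ℕ) (_hℓ : 2 ≤ ℓ) :
    ((range (D + u)).filter (fun i => lfTopAll ℓ D i = 1)).card = D := by
  have : (range (D + u)).filter (fun i => lfTopAll ℓ D i = 1) = range D := by
    ext i
    simp only [mem_filter, mem_range]
    unfold lfTopAll
    have := lfRR_bounds (ℓ - 1) 0 (i - D) (by omega)
    constructor
    · rintro ⟨hi, hv⟩
      split_ifs at hv <;> omega
    · intro hi
      exact ⟨by omega, if_pos hi⟩
  rw [this, card_range]

/-- The class of a carrier `1 + v` (`1 ≤ v ≤ ℓ − 1`): the balanced count `u / (ℓ − 1) + [v − 1 < u mod (ℓ − 1)]`. -/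
theorem cls_lfTopAll_carrier (ℓ D u v : ℕ) (_hℓ : 2 ≤ ℓ) (hv1 : 1 ≤ v) (hv2 : v ≤ ℓ - 1) :
    ((range (D + u)).filter (fun i => lfTopAll ℓ D i = 1 + v)).card =
      u / (ℓ - 1) + if v - 1 < u % (ℓ - 1) then 1 else 0 := by
  have hc := cls_lfRR_zero (ℓ - 1) u (v - 1) (by omega) (by omega)
  unfold cls at hc
  have e : v - 1 + 1 = v := by omega
  rw [e] at hc
  rw [← hc]
  -- the filter on `range (D + u)` is the shift of the filter on `range u`
  have : (range (D + u)).filter (fun i => lfTopAll ℓ D i = 1 + v) =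
      ((range u).filter (fun i => lfRR (ℓ - 1) 0 i = v)).image (fun i => D + i) := by
    ext i
    simp only [mem_filter, mem_range, mem_image]
    unfold lfTopAll
    constructor
    · rintro ⟨hi, hv⟩
      split_ifs at hv with h
      · omega
      · exact ⟨i - D, ⟨by omega, by omega⟩, by omega⟩
    · rintro ⟨i', ⟨hi', hv'⟩, rfl⟩
      refine ⟨by omega, ?_⟩
      rw [if_neg (by omega), Nat.add_sub_cancel_left, hv']
  rw [this, card_image_of_injective _ (fun a b h => by simpa using h)]

/-- **THE ROUND-ROBIN WITNESS:** for `2 ≤ ℓ`, `1 ≤ u`, `u + 1 ≤ t`, `u ≤ (ℓ − 1)(t − u)`, `2 t ≤ s`, a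
triangle-free graph on `ℓ + 1 + (s − t)` vertices with `s` edges, a vertex `w` of degree `s − t`, every
off-degree `≤ t − u`, a non-neighbour of off-degree `t − u`, and the band value `2 j = deepTop t (ℓ − 1) u`. -/
theorem topAllWitness (s ℓ t u : ℕ) (hℓ : 2 ≤ ℓ) (hu : 1 ≤ u) (hut : u + 1 ≤ t) (hfit : u ≤ (ℓ - 1) * (t - u))
    (hs : 2 * t ≤ s) :
    ∃ (H : SimpleGraph (Fin (ℓ + 1 + (s - t)))) (_ : DecidableRel H.Adj), H.CliqueFree 3 ∧
      H.edgeFinset.card = s ∧ ∃ w, deg H w + t = s ∧ (∀ v, offDeg H w v + u ≤ t) ∧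
        (∃ x, ¬ H.Adj w x ∧ offDeg H w x + u = t) ∧
        ∑ v, deg H v * deg H v + 2 * (t * (s - t - 1)) + deepTop t (ℓ - 1) u = s * (s + 1) := by
  set D := t - u with hDdef
  have htD : t = D + u := by omega
  set n := ℓ + 1 + (s - t) with hn
  have hn0 : 0 < n := by omega
  have hg := goodEnds_topAll s ℓ t D hℓ hs
  have hval := genWitness_missing_value n (ℓ + 1) s t hn0 (lfTopAll ℓ D) (rfFresh ℓ) hg (by omega) (by omega)
    (by omega) (by omega)
  have hatt : ((range t).filter (fun i => rfFresh ℓ i < ℓ + 1 + (s - t))).card = t := by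
    rw [filter_true_of_mem (fun i hi => by
      rw [mem_range] at hi
      unfold rfFresh
      omega), card_range]
  have hcl : coll t (lfTopAll ℓ D) = D * (D - 1) + coll u (lfRR (ℓ - 1) 0) := by
    rw [htD]
    exact coll_lfTopAll ℓ D u hℓ
  rw [hatt, hcl, coll_rfFresh, add_zero, Nat.sub_self, mul_zero, zero_add] at hval
  have hid := subband_identity t u hut
  rw [← hDdef] at hid
  have hcle := coll_le u (lfRR (ℓ - 1) 0)
  have hu1 : u * (u - 1) ≤ u * (u + 1) := Nat.mul_le_mul_left u (by omega)
  have hdt : deepTop t (ℓ - 1) u = 2 * (u * (t - u - 1)) + (u * (u + 1) - coll u (lfRR (ℓ - 1) 0)) := rfl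
  rw [← hDdef] at hdt
  have e : t * (t - 1) - (D * (D - 1) + coll u (lfRR (ℓ - 1) 0)) = deepTop t (ℓ - 1) u := by
    rw [hdt]
    omega
  rw [e] at hval
  -- the carriers' counts are at most `D`
  have hcarrier : ∀ v, 1 ≤ v → v ≤ ℓ - 1 →
      u / (ℓ - 1) + (if v - 1 < u % (ℓ - 1) then 1 else 0) ≤ D := by
    intro v hv1 hv2
    have hdiv := Nat.div_add_mod u (ℓ - 1)
    have hmod := Nat.mod_lt u (show 0 < ℓ - 1 by omega)
    have hq : u / (ℓ - 1) ≤ D := by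
      apply Nat.div_le_of_le_mul
      linarith [mul_comm (ℓ - 1) D]
    split_ifs with h
    · by_contra hcon
      have hqD : u / (ℓ - 1) = D := by omega
      rw [hqD] at hdiv
      omega
    · omega
  refine ⟨_, inferInstance, cliqueFree_of_bipSub _ _ (bipSub_missingGraph _ _),
    card_edges_missingGraph_genWitness n (ℓ + 1) s t hn0 (lfTopAll ℓ D) (rfFresh ℓ) hg (by omega) (by omega)
      (by omega), fin' n hn0 0, ?_, ?_, ?_, hval⟩
  · rw [deg_missingGraph_genWitness_zero n (ℓ + 1) s t hn0 (lfTopAll ℓ D) (rfFresh ℓ) hg (by omega) (by omega)]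
    omega
  · intro v
    have hv : v = fin' n hn0 v.val := Fin.ext (by rw [fin'_val n hn0 v.val v.isLt])
    rw [hv]
    by_cases hva : v.val < ℓ + 1
    · rw [offDeg_genWitness_left n (ℓ + 1) s t hn0 (lfTopAll ℓ D) (rfFresh ℓ) hg (by omega) v.val hva, htD]
      rcases (show v.val = 0 ∨ v.val = 1 ∨ (2 ≤ v.val ∧ v.val ≤ ℓ) by omega) with h0 | h1 | ⟨h2, h3⟩
      · rw [h0, card_eq_zero.mpr (filter_eq_empty_iff.mpr (fun i _ hv' => by
          have := lfTopAll_bounds ℓ D i hℓ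
          omega))]
        omega
      · rw [h1, cls_lfTopAll_one ℓ D u hℓ]
      · obtain ⟨v', hv'⟩ : ∃ v', v.val = 1 + v' := ⟨v.val - 1, by omega⟩
        rw [hv', cls_lfTopAll_carrier ℓ D u v' hℓ (by omega) (by omega)]
        have := hcarrier v' (by omega) (by omega)
        omega
    · rw [offDeg_genWitness_right n (ℓ + 1) s t hn0 (lfTopAll ℓ D) (rfFresh ℓ) hg (by omega) v.val (by omega)
        v.isLt]
      have : ((range t).filter (fun i => rfFresh ℓ i = v.val)).card ≤ 1 := by
        rw [card_le_one]
        intro i hi i' hi'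
        rw [mem_filter] at hi hi'
        unfold rfFresh at hi hi'
        omega
      omega
  · refine ⟨fin' n hn0 1, not_adj_genWitness_one n (ℓ + 1) s t hn0 (lfTopAll ℓ D) (rfFresh ℓ) (by omega)
      (by omega), ?_⟩
    rw [offDeg_genWitness_left n (ℓ + 1) s t hn0 (lfTopAll ℓ D) (rfFresh ℓ) hg (by omega) 1 (by omega), htD,
      cls_lfTopAll_one ℓ D u hℓ]

/-- **THE TOP OF THE SUB-BAND `u ≥ ℓ − 1`, EVERY `ℓ`:** for `2 ≤ ℓ`, `ℓ − 1 ≤ u`, `u + 1 ≤ t`, `u ≤ (ℓ − 1)(t − u)`,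
`2 t ≤ s`: every graph on `ℓ + 1 + (s − t)` vertices with a vertex `w` of degree `s − t` and maximum off-degree
exactly `t − u` has `2 j ≤ deepTop t (ℓ − 1) u`, and the round robin attains `2 j = deepTop t (ℓ − 1) u`. -/
theorem deep_top_max (s ℓ t u : ℕ) (hℓ : 2 ≤ ℓ) (hℓu : ℓ - 1 ≤ u) (hut : u + 1 ≤ t) (hfit : u ≤ (ℓ - 1) * (t - u))
    (hs : 2 * t ≤ s) :
    (∀ (H : SimpleGraph (Fin (ℓ + 1 + (s - t)))) [DecidableRel H.Adj], H.CliqueFree 3 →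
      H.edgeFinset.card = s → ∀ w, deg H w + t = s → (∀ v, offDeg H w v + u ≤ t) → (∃ x, offDeg H w x + u = t) →
      ∀ j, ∑ v, deg H v * deg H v + 2 * (t * (s - t - 1)) + 2 * j = s * (s + 1) →
      2 * j ≤ deepTop t (ℓ - 1) u) ∧
    (∃ (H : SimpleGraph (Fin (ℓ + 1 + (s - t)))) (_ : DecidableRel H.Adj), H.CliqueFree 3 ∧
      H.edgeFinset.card = s ∧ ∃ w, deg H w + t = s ∧ (∀ v, offDeg H w v + u ≤ t) ∧
        (∃ x, ¬ H.Adj w x ∧ offDeg H w x + u = t) ∧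
        ∑ v, deg H v * deg H v + 2 * (t * (s - t - 1)) + deepTop t (ℓ - 1) u = s * (s + 1)) := by
  refine ⟨fun H _ hfree hsH w hw hmax ⟨x, hx⟩ j hj => ?_, topAllWitness s ℓ t u hℓ (by omega) hut hfit hs⟩
  have hcard : (nonNbrs H w).card = ℓ := by
    have := card_nonNbrs_add H w
    rw [Fintype.card_fin] at this
    omega
  have hw1 : 1 ≤ deg H w := by omega
  have hb := subband_upper_bound_max H hfree s t u j hsH w hw hw1 hj hmax x hx (by omega) hut (by omega)
  rw [hcard] at hb
  have htw : twoW ℓ u = u * (u + 1) - coll u (lfRR (ℓ - 1) 0) := by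
    unfold twoW
    have : ℓ - 1 - u = 0 := by omega
    rw [this, mul_zero, add_zero]
  rw [htw] at hb
  unfold deepTop
  exact hb

end C047

end TriangleCap

end PercRepro
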